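import Summits.AtomisticToContinuum.Crystallization.Theorems.ChartedPlanarOrderMesoCut
import Summits.AtomisticToContinuum.Crystallization.Theorems.OverbindingBudgetElasticSplitStatements

/-!
# OverbindingBudget × ChartedPlanarOrder — the Liouville dictionary edge (lens-4 g28, helper for RDEF stmt-31280)

Convergence #3 of the cell (critic row 393) declared the IDEA-NEEDED residual of the OverbindingBudget elastic split,
`ShearFreeLiouvilleLaw` (lens-4, `…OverbindingBudgetElasticSplitShear`), and lens-3's homogeneity column L1′
`DoorHomogeneity := ∀ δ τ r > 0, ∀ S, IsDoorSet δ S → NearHom τ r S S` (HOME, un-landed) to be «the same core, two dialects», and asked for the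
dictionary edge: a binder comparison plus one proved implication or the precise mismatch.  This file is that edge, 0 sorry.  Findings:

1. **The homogeneity currency `NearHom` of `…ChartedPlanarOrderMesoCut` is vacuous** (§1): its linear map `L : E3 →L[ℝ] E3` may be `0`, and
   `LayeredHom 0 w = range w`; enumerating the (countable) separated configuration `S` by `w` gives `NearHom τ r S Q` for EVERY `Q ⊆ S`, every
   `τ ≥ 0` and every `r` (`nearHom_of_isSep`).  Hence the TEXT of L1′ is a theorem (`doorHomogeneity_text`), the near-homogeneity hypothesis of
   HBG♮ `NearHomBulkGap` is void — HBG♮ is literally «BULK on entirely-bad clean chunks» (`nearHomBulkGap_iff_allBad`) — and the text of lens-3's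
   HBG♮(u) `NearHomBulkGapDense` is literally BULK `BulkDefectGap` (`bulkDefectGap_iff_denseText`): the cut `L1′ ∧ HBG♮(u) ⟹ BULK|door` is
   `BULK ⟹ BULK|door` in costume.  (Landed theorems of `…MesoCut` are all correct; only the informal reading of `NearHom` as «near ONE homogeneous
   layered structure» fails.)
2. **Requiring `L` invertible does not repair the chunk-level statements** (§2): with the homothety `L = K • id`, `K > 2r + diam Q`, and `w`
   enumerating the finitely many atoms within `r` of a FINITE chunk `Q`, again `NearHomInv τ r S Q` holds (`nearHomInv_of_finite`); so HBG♮,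
   HBG♮(u) and every chunk-level clause typed over an `≃L`-variant stay vacuous — only the global statement `Q = S` (infinite) gains content.
3. **A contentful repair** (§3): bound the distortion, `‖L‖ ≤ Λ ∧ ‖L⁻¹‖ ≤ Λ` (`NearHomBD Λ`).  Non-vacuity witness: an isolated atom is NOT
   `(Λ, τ, r)`-near-homogeneous once `Λ ≤ r` and `Λ τ < 1` (`not_nearHomBD_singleton`), while it IS `NearHom`-homogeneous (`nearHom_singleton`).
4. **Binder edge** (§4): lens-4's `LocallyOptimal` (count-preserving finite surgeries do not pay) implies lens-3's single-site `IsNash`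
   (`isNash_of_locallyOptimal`, surgery `F = {p}`, `G = {y}`); lens-4's `UniformlyDiscrete` is lens-3's `∃ δ > 0, IsSep δ` (`uniformlyDiscrete_iff_isSep`).
   The remaining binders do NOT match (recorded, not provable either way): `RT a T₀` (first shell `[a(1-1/50)-T₀, a(1+1/50)+T₀]`, exactly-12 by
   count, gap to `a·63/50 - T₀`, second shell free) vs `IsTwoShellGoodSet (1/16) (9/10) 1` (tolerance `1/16`, second shell constrained);
   `UniformlyRecurrent` (almost periodicity) vs `IsCharted` (a bond-graph chart from ONE Barlow stacking); `VirialBalanced ∧ StressFree` have no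
   lens-3 counterpart (lens-3 carries energy `excess`, lens-4 carries the virial).  CONCLUSIONS: lens-4's `¬ StrainedCubes κ` / `RT a' t`-cleanness
   at a common scale `a'` is INTRINSIC (distances inside `Y` only — immune to the vacuity above); lens-3's is EXTRINSIC (closeness to a model set
   `LayeredHom L w`) and needs the model family to be rigid enough to say anything — that is the whole of the mismatch, and the reason the common
   core of convergence #3 should be typed in the intrinsic currency (or over `NearHomBD`).

No new axioms, instances or notation; helper defs `NearHomInv`, `NearHomBD` are local typing proposals, not route items.
-/

noncomputable section

open MeasureTheory Set Metric
open scoped BigOperators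
open Literature.MathematicalPhysics.StatisticalMechanics
open Summit.AtomisticToContinuum.Crystallization.Theorems.ChartedPlanarOrderRigidityDoor
open Summit.AtomisticToContinuum.Crystallization.Theorems.ChartedPlanarOrderDensityDichotomy
open Summit.AtomisticToContinuum.Crystallization.Theorems.ChartedPlanarOrderMesoCut
open Summit.AtomisticToContinuum.Crystallization.Theorems.OverbindingBudgetElasticSplitStatements (surgeryGain LocallyOptimal)

namespace Summit.AtomisticToContinuum.Crystallization.Theorems.OverbindingBudgetLiouvilleDictionary

/-! ## §1  Vacuity of `NearHom` (`L = 0`) and its consequences for L1′, HBG♮, HBG♮(u) -/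

/-- with the zero linear map the «layered structure» is just the range of the offset sequence. -/
theorem layeredHom_zero (w : ℤ → E3) : LayeredHom 0 w = Set.range w := by
  ext p
  simp only [LayeredHom, zero_apply, zero_add, Set.mem_setOf_eq, Set.mem_range]
  constructor
  · rintro ⟨m, -, -, rfl⟩
    exact ⟨m, rfl⟩
  · rintro ⟨m, rfl⟩
    exact ⟨m, 0, 0, rfl⟩

/-- a `δ`-separated set (`δ > 0`) is countable. -/
theorem countable_of_isSep {δ : ℝ} (hδ : 0 < δ) {S : Set E3} (hS : IsSep δ S) : S.Countable := by
  have h : S = ⋃ n : ℕ, (Metric.closedBall (0 : E3) n ∩ S) := by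
    ext p
    simp only [Set.mem_iUnion, Set.mem_inter_iff, Metric.mem_closedBall]
    exact ⟨fun hp => by obtain ⟨n, hn⟩ := exists_nat_ge (dist p 0); exact ⟨n, hn, hp⟩, fun ⟨n, _, hp⟩ => hp⟩
  rw [h]
  exact Set.countable_iUnion fun n =>
    (Literature.Probability.Process.LocalConfig.finite_inter_of_separated hδ hS (isCompact_closedBall (0 : E3) n)).countable

/-- **Vacuity of `NearHom`:** every `Q ⊆ S` of a countable configuration `S` is `(τ, r)`-near-homogeneous for every `τ ≥ 0` and every `r`
(`L = 0`, `w` an enumeration of `S`, `Ψ = id`). -/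
theorem nearHom_of_countable {τ r : ℝ} (hτ : 0 ≤ τ) {S Q : Set E3} (hQS : Q ⊆ S) (hS : S.Countable) :
    NearHom τ r S Q := by
  rcases S.eq_empty_or_nonempty with hSe | hSne
  · subst hSe
    have hQ : Q = ∅ := Set.subset_eq_empty hQS rfl
    subst hQ
    exact ⟨0, fun _ => 0, id, Set.injOn_id _, fun x hx => hx.elim, fun x hx => hx.elim⟩
  obtain ⟨f, hf⟩ := hS.exists_eq_range hSne
  have hw : Set.range (fun m : ℤ => f m.natAbs) = S := by
    rw [hf]
    ext p
    simp only [Set.mem_range]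
    exact ⟨fun ⟨m, hm⟩ => ⟨m.natAbs, hm⟩, fun ⟨n, hn⟩ => ⟨(n : ℤ), by simpa using hn⟩⟩
  refine ⟨0, fun m : ℤ => f m.natAbs, id, Set.injOn_id _, fun x hx => ?_, fun x hx => ?_⟩
  · rw [layeredHom_zero, hw]
    exact hQS hx
  · rw [layeredHom_zero, hw]
    exact ⟨fun p hp _ => ⟨p, hp, by simpa using hτ⟩, fun q hq _ => ⟨q, hq, by simpa using hτ⟩⟩

/-- … in particular for every separated configuration. -/
theorem nearHom_of_isSep {δ τ r : ℝ} (hδ : 0 < δ) (hτ : 0 ≤ τ) {S Q : Set E3} (hS : IsSep δ S) (hQS : Q ⊆ S) :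
    NearHom τ r S Q :=
  nearHom_of_countable hτ hQS (countable_of_isSep hδ hS)

/-- an isolated atom is `NearHom`-near-homogeneous (contrast with `not_nearHomBD_singleton` below). -/
theorem nearHom_singleton {τ r : ℝ} (hτ : 0 ≤ τ) (x : E3) : NearHom τ r {x} {x} :=
  nearHom_of_countable hτ subset_rfl (Set.countable_singleton x)

/-- **L1′ is a theorem as typed:** the text of lens-3's `DoorHomogeneity` (HOME `ChartedPlanarOrderHomCut.lean`, un-landed) holds. -/
theorem doorHomogeneity_text :
    ∀ δ : ℝ, 0 < δ → ∀ τ : ℝ, 0 < τ → ∀ r : ℝ, 0 < r → ∀ S : Set E3, IsDoorSet δ S → NearHom τ r S S :=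
  fun _ hδ _ hτ _ _ _ hS => nearHom_of_isSep hδ hτ.le hS.2.1 subset_rfl

/-- **HBG♮ unmasked:** the tree's `NearHomBulkGap` is equivalent to BULK restricted to entirely-`θ`-bad clean chunks (`u = 1`), with no
homogeneity hypothesis and no slack. -/
theorem nearHomBulkGap_iff_allBad :
    NearHomBulkGap ↔
      ∀ δ : ℝ, 0 < δ → ∀ θ : ℝ, 0 < θ → θ ≤ 1 / 16 → ∃ η : ℝ, 0 < η ∧ ∃ C : ℝ, 0 ≤ C ∧ ∃ r : ℝ, 0 < r ∧
        ∀ S Q : Set E3, IsSep δ S → IsCleanChunk S Q → nK Q ≤ nBad θ S Q → η * nK Q ≤ excess S Q + C * nBdry r S Q := by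
  constructor
  · intro h δ hδ θ hθ hθ'
    obtain ⟨η, hη, h1⟩ := h δ hδ θ hθ hθ'
    obtain ⟨τ, hτ, r, -, C, hC, r', hr', h2⟩ := h1 (η / 2) (by positivity)
    refine ⟨η / 2, by positivity, C, hC, r', hr', fun S Q hS hQ hbad => ?_⟩
    have h3 := h2 S Q hS hQ (nearHom_of_isSep (r := r) hδ hτ.le hS hQ.1) hbad
    linarith
  · intro h δ hδ θ hθ hθ'
    obtain ⟨η, hη, C, hC, r, hr, h1⟩ := h δ hδ θ hθ hθ'
    refine ⟨η, hη, fun ε hε => ⟨1, one_pos, 1, one_pos, C, hC, r, hr, fun S Q hS hQ _ hbad => ?_⟩⟩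
    have h2 := h1 S Q hS hQ hbad
    have h3 : 0 ≤ ε * nK Q := mul_nonneg hε.le (nK_nonneg Q)
    linarith

/-- **HBG♮(u) unmasked:** the text of lens-3's `NearHomBulkGapDense` (HOME `ChartedPlanarOrderHomCut.lean`) is equivalent to BULK
`BulkDefectGap` itself — so the proposed reduction `bulkDoor_of_hom : L1′ → HBG♮(u) → BULK|door` is `BULK → BULK|door`. -/
theorem bulkDefectGap_iff_denseText :
    BulkDefectGap ↔
      ∀ δ : ℝ, 0 < δ → ∀ θ : ℝ, 0 < θ → θ ≤ 1 / 16 → ∀ u : ℝ, 0 < u → u ≤ 1 → ∃ η : ℝ, 0 < η ∧ ∀ ε : ℝ, 0 < ε →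
        ∃ τ : ℝ, 0 < τ ∧ ∃ r : ℝ, 0 < r ∧ ∃ C : ℝ, 0 ≤ C ∧ ∃ r' : ℝ, 0 < r' ∧
          ∀ S Q : Set E3, IsSep δ S → IsCleanChunk S Q → NearHom τ r S Q → u * nK Q ≤ nBad θ S Q →
            η * nK Q ≤ excess S Q + C * nBdry r' S Q + ε * nK Q := by
  constructor
  · intro h δ hδ θ hθ hθ' u hu hu1
    obtain ⟨η, hη, C, hC, r, hr, h1⟩ := h δ hδ θ hθ hθ' u hu hu1
    refine ⟨η, hη, fun ε hε => ⟨1, one_pos, 1, one_pos, C, hC, r, hr, fun S Q hS hQ _ hbad => ?_⟩⟩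
    have h2 := h1 S Q hS hQ hbad
    have h3 : 0 ≤ ε * nK Q := mul_nonneg hε.le (nK_nonneg Q)
    linarith
  · intro h δ hδ θ hθ hθ' u hu hu1
    obtain ⟨η, hη, h1⟩ := h δ hδ θ hθ hθ' u hu hu1
    obtain ⟨τ, hτ, r, -, C, hC, r', hr', h2⟩ := h1 (η / 2) (by positivity)
    refine ⟨η / 2, by positivity, C, hC, r', hr', fun S Q hS hQ hbad => ?_⟩
    have h3 := h2 S Q hS hQ (nearHom_of_isSep (r := r) hδ hτ.le hS hQ.1) hbad
    linarith

/-! ## §2  Invertible `L` does not repair the chunk-level statements -/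

/-- the `≃L`-variant of `NearHom` (lens-3's ProfileSlaving-style repair): the model map is a continuous linear AUTOMORPHISM. -/
def NearHomInv (τ r : ℝ) (S Q : Set E3) : Prop :=
  ∃ (L : E3 ≃L[ℝ] E3) (w : ℤ → E3) (Ψ : E3 → E3), Set.InjOn Ψ Q ∧ Set.MapsTo Ψ Q (LayeredHom (L : E3 →L[ℝ] E3) w) ∧
    ∀ x ∈ Q, EnvClose τ r S x (LayeredHom (L : E3 →L[ℝ] E3) w) (Ψ x)

/-- the `≃L`-variant implies the tree's `NearHom`. -/
theorem nearHom_of_nearHomInv {τ r : ℝ} {S Q : Set E3} (h : NearHomInv τ r S Q) : NearHom τ r S Q := by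
  obtain ⟨L, w, Ψ, h1, h2, h3⟩ := h
  exact ⟨(L : E3 →L[ℝ] E3), w, Ψ, h1, h2, h3⟩

/-- in-layer lattice vectors have norm `≥ 1` off the origin (spacing-`1` triangular lattice). -/
theorem one_le_norm_latticeVec {i j : ℤ} (hne : (i, j) ≠ (0, 0)) :
    1 ≤ ‖(i : ℝ) • triangularVec₁ 1 + (j : ℝ) • triangularVec₂ 1‖ := by
  have h := le_dist_barlowPos_of_ne 1 0 (fun _ => 0) zero_le_one (k := 0) hne
  have hsub : barlowPos 1 0 (fun _ => 0) 0 i j - barlowPos 1 0 (fun _ => 0) 0 0 0 =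
      (i : ℝ) • triangularVec₁ 1 + (j : ℝ) • triangularVec₂ 1 := by
    simp only [barlowPos, Int.cast_zero, zero_smul, zero_add, add_zero]
    abel
  rwa [dist_eq_norm, hsub] at h

/-- **`NearHomInv` is still vacuous on finite chunks:** for a `δ`-separated `S`, a finite `Q ⊆ S`, `τ ≥ 0`, `r ≥ 0`, take `L = K • id` with
`K = 2r + diam Q + 1` and `w` an enumeration of the (finitely many) atoms of `S` within `r` of `Q`: every non-trivial lattice step of a model
layer then leaves the `r`-neighbourhood of `Q`, so the envelope conditions only ever see the atoms themselves. -/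
theorem nearHomInv_of_finite {δ τ r : ℝ} (hδ : 0 < δ) (hτ : 0 ≤ τ) (hr : 0 ≤ r) {S Q : Set E3} (hS : IsSep δ S) (hQS : Q ⊆ S)
    (hQ : Q.Finite) : NearHomInv τ r S Q := by
  rcases Q.eq_empty_or_nonempty with hQe | hQne
  · subst hQe
    exact ⟨ContinuousLinearEquiv.refl ℝ E3, fun _ => 0, id, Set.injOn_id _, fun x hx => hx.elim, fun x hx => hx.elim⟩
  -- a bound on the distances inside `Q`
  obtain ⟨D, hD⟩ := Metric.isBounded_iff.1 hQ.isBounded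
  have hD0 : 0 ≤ D := by
    obtain ⟨x, hx⟩ := hQne
    have := hD hx hx
    rwa [dist_self] at this
  -- the atoms of `S` within `r` of `Q`
  set N : Set E3 := {p | p ∈ S ∧ ∃ x ∈ Q, dist p x ≤ r} with hN
  have hNfin : N.Finite := by
    refine (Set.Finite.biUnion hQ fun x _ =>
      Literature.Probability.Process.LocalConfig.finite_inter_of_separated hδ hS (isCompact_closedBall x r)).subset ?_
    rintro p ⟨hpS, x, hxQ, hpx⟩
    exact Set.mem_biUnion hxQ ⟨Metric.mem_closedBall.2 hpx, hpS⟩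
  have hQN : Q ⊆ N := fun x hx => ⟨hQS hx, x, hx, by rw [dist_self]; exact hr⟩
  have hNS : N ⊆ S := fun p hp => hp.1
  obtain ⟨f, hf⟩ := hNfin.countable.exists_eq_range (hQne.mono hQN)
  have hw : Set.range (fun m : ℤ => f m.natAbs) = N := by
    rw [hf]
    ext p
    simp only [Set.mem_range]
    exact ⟨fun ⟨m, hm⟩ => ⟨m.natAbs, hm⟩, fun ⟨n, hn⟩ => ⟨(n : ℤ), by simpa using hn⟩⟩
  -- the homothety `K • id`
  set K : ℝ := 2 * r + D + 1 with hK
  have hK0 : 0 < K := by rw [hK]; linarith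
  let L : E3 ≃L[ℝ] E3 :=
    ContinuousLinearEquiv.equivOfInverse (K • ContinuousLinearMap.id ℝ E3) (K⁻¹ • ContinuousLinearMap.id ℝ E3)
      (fun x => by simp [smul_smul, hK0.ne']) (fun x => by simp [smul_smul, hK0.ne'])
  have hL : ∀ v : E3, (L : E3 →L[ℝ] E3) v = K • v := fun v => by
    simp [L]
  -- membership in the model set
  have hmemN : ∀ p ∈ N, p ∈ LayeredHom (L : E3 →L[ℝ] E3) (fun m : ℤ => f m.natAbs) := by
    intro p hp
    rw [← hw] at hp
    obtain ⟨m, hm⟩ := hp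
    refine ⟨m, 0, 0, ?_⟩
    simp only [Int.cast_zero, zero_smul, add_zero, map_zero, zero_add]
    exact hm.symm
  refine ⟨L, fun m : ℤ => f m.natAbs, id, Set.injOn_id _, fun x hx => hmemN x (hQN hx), fun x hx => ⟨?_, ?_⟩⟩
  · intro p hpS hpx
    exact ⟨p, hmemN p ⟨hpS, x, hx, hpx⟩, by simpa using hτ⟩
  · rintro q ⟨m, i, j, hq⟩ hqx
    change dist q x ≤ r at hqx
    by_cases hij : (i, j) = (0, 0)
    · obtain ⟨rfl, rfl⟩ := Prod.mk_inj.1 hij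
      have hqN : q ∈ N := by
        rw [← hw]
        refine ⟨m, ?_⟩
        rw [hq]
        simp only [Int.cast_zero, zero_smul, add_zero, map_zero, zero_add]
      exact ⟨q, hNS hqN, by simpa using hτ⟩
    · exfalso
      have hwm : f m.natAbs ∈ N := by rw [← hw]; exact ⟨m, rfl⟩
      obtain ⟨-, x', hx'Q, hwx'⟩ := hwm
      have h1 : K ≤ ‖(L : E3 →L[ℝ] E3) ((i : ℝ) • triangularVec₁ 1 + (j : ℝ) • triangularVec₂ 1)‖ := by
        rw [hL, norm_smul, Real.norm_eq_abs, abs_of_pos hK0]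
        simpa using mul_le_mul_of_nonneg_left (one_le_norm_latticeVec hij) hK0.le
      have h2 : ‖(L : E3 →L[ℝ] E3) ((i : ℝ) • triangularVec₁ 1 + (j : ℝ) • triangularVec₂ 1)‖ = dist q (f m.natAbs) := by
        rw [dist_eq_norm, hq, add_sub_cancel_right]
      have h3 : dist q (f m.natAbs) ≤ r + D + r :=
        calc dist q (f m.natAbs) ≤ dist q x + dist x x' + dist x' (f m.natAbs) := dist_triangle4 _ _ _ _
          _ ≤ r + D + r := by
            have := hD hx hx'Q
            have := dist_comm x' (f m.natAbs) ▸ hwx'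
            linarith
      rw [hK] at h1
      linarith

/-! ## §3  A contentful repair: bounded distortion -/

/-- `NearHomBD Λ τ r S Q`: `NearHom` with the model map a continuous linear automorphism of distortion `≤ Λ` (`‖L‖ ≤ Λ`, `‖L⁻¹‖ ≤ Λ`).
Proposed common typing for the homogeneity currency of convergence #3 (alternative: lens-4's intrinsic `RT`-at-a-common-scale currency). -/
def NearHomBD (Λ τ r : ℝ) (S Q : Set E3) : Prop :=
  ∃ (L : E3 ≃L[ℝ] E3), ‖(L : E3 →L[ℝ] E3)‖ ≤ Λ ∧ ‖(L.symm : E3 →L[ℝ] E3)‖ ≤ Λ ∧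
    ∃ (w : ℤ → E3) (Ψ : E3 → E3), Set.InjOn Ψ Q ∧ Set.MapsTo Ψ Q (LayeredHom (L : E3 →L[ℝ] E3) w) ∧
      ∀ x ∈ Q, EnvClose τ r S x (LayeredHom (L : E3 →L[ℝ] E3) w) (Ψ x)

/-- bounded distortion implies the `≃L`-variant. -/
theorem nearHomInv_of_nearHomBD {Λ τ r : ℝ} {S Q : Set E3} (h : NearHomBD Λ τ r S Q) : NearHomInv τ r S Q := by
  obtain ⟨L, -, -, w, Ψ, h1, h2, h3⟩ := h
  exact ⟨L, w, Ψ, h1, h2, h3⟩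

/-- bounded distortion implies the tree's `NearHom`. -/
theorem nearHom_of_nearHomBD {Λ τ r : ℝ} {S Q : Set E3} (h : NearHomBD Λ τ r S Q) : NearHom τ r S Q :=
  nearHom_of_nearHomInv (nearHomInv_of_nearHomBD h)

/-- the first triangular generator at spacing `1` is a unit vector. -/
theorem norm_triangularVec₁_one : ‖triangularVec₁ 1‖ = 1 := by
  rw [EuclideanSpace.norm_eq, Fin.sum_univ_three]
  simp [triangularVec₁]

/-- **Non-vacuity of `NearHomBD`:** an isolated atom is not `(Λ, τ, r)`-near-homogeneous when `Λ ≤ r` and `Λ τ < 1` — the model layer through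
its image contains a second model point within `‖L‖ ≤ Λ ≤ r`, which must be `τ`-matched by an atom, and there is none. -/
theorem not_nearHomBD_singleton {Λ τ r : ℝ} (hΛr : Λ ≤ r) (hΛτ : Λ * τ < 1) (x : E3) : ¬ NearHomBD Λ τ r {x} {x} := by
  rintro ⟨L, hL, hL', w, Ψ, -, hmaps, henv⟩
  have hx : Ψ x ∈ LayeredHom (L : E3 →L[ℝ] E3) w := hmaps (Set.mem_singleton x)
  obtain ⟨m, i, j, hΨ⟩ := hx
  obtain ⟨-, h2⟩ := henv x (Set.mem_singleton x)
  -- the neighbouring model point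
  set q : E3 := (L : E3 →L[ℝ] E3) (((i + 1 : ℤ) : ℝ) • triangularVec₁ 1 + (j : ℝ) • triangularVec₂ 1) + w m with hq
  have hqH : q ∈ LayeredHom (L : E3 →L[ℝ] E3) w := ⟨m, i + 1, j, rfl⟩
  have hdiff : q - Ψ x = (L : E3 →L[ℝ] E3) (triangularVec₁ 1) := by
    rw [hq, hΨ, add_sub_add_right_eq_sub, ← map_sub]
    congr 1
    push_cast
    rw [add_smul, one_smul]
    abel
  have hnorm : ‖q - Ψ x‖ ≤ Λ := by
    rw [hdiff]
    calc ‖(L : E3 →L[ℝ] E3) (triangularVec₁ 1)‖ ≤ ‖(L : E3 →L[ℝ] E3)‖ * ‖triangularVec₁ 1‖ := ContinuousLinearMap.le_opNorm _ _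
      _ ≤ Λ * 1 := by rw [norm_triangularVec₁_one]; exact mul_le_mul_of_nonneg_right hL zero_le_one
      _ = Λ := mul_one Λ
  have hqx : dist q (Ψ x) ≤ r := by rw [dist_eq_norm]; exact hnorm.trans hΛr
  obtain ⟨p, hp, hpq⟩ := h2 q hqH hqx
  rw [Set.mem_singleton_iff] at hp
  subst hp
  rw [sub_self, dist_eq_norm, zero_sub, norm_neg, hdiff] at hpq
  -- pull back by `L⁻¹`
  have h1 : ‖triangularVec₁ 1‖ ≤ Λ * τ :=
    calc ‖triangularVec₁ 1‖ = ‖(L.symm : E3 →L[ℝ] E3) ((L : E3 →L[ℝ] E3) (triangularVec₁ 1))‖ := by simp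
      _ ≤ ‖(L.symm : E3 →L[ℝ] E3)‖ * ‖(L : E3 →L[ℝ] E3) (triangularVec₁ 1)‖ := ContinuousLinearMap.le_opNorm _ _
      _ ≤ Λ * τ := mul_le_mul hL' hpq (norm_nonneg _) ((norm_nonneg _).trans hL')
  rw [norm_triangularVec₁_one] at h1
  linarith

/-! ## §4  The binder edge: `LocallyOptimal ⟹ IsNash`, `UniformlyDiscrete ↔ ∃ δ, IsSep δ` -/

/-- lens-4's uniform discreteness is lens-3's separation. -/
theorem uniformlyDiscrete_iff_isSep (Y : Set E3) : UniformlyDiscrete Y ↔ ∃ δ : ℝ, 0 < δ ∧ IsSep δ Y := Iff.rfl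

/-- **lens-4's local optimality implies lens-3's single-site Nash stationarity** (the one-atom surgery `F = {p}`, `G = {y}`). -/
theorem isNash_of_locallyOptimal {Y : Set E3} (h : LocallyOptimal Y) : IsNash (μS Y) := by
  intro p hp y hy
  rw [Literature.Probability.Process.count_restrict_singleton_ne_zero_iff] at hp
  have hy' : ∀ q ∈ Y, q ≠ p → y ≠ q := fun q hq =>
    hy q ((Literature.Probability.Process.count_restrict_singleton_ne_zero_iff Y q).2 hq)
  -- the surgery
  have hF : (↑({p} : Finset E3) : Set E3) ⊆ Y := by
    rw [Finset.coe_singleton, Set.singleton_subset_iff]; exact hp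
  have hG : Disjoint (↑({y} : Finset E3) : Set E3) (Y \ ↑({p} : Finset E3)) := by
    rw [Finset.coe_singleton, Finset.coe_singleton, Set.disjoint_singleton_left]
    rintro ⟨hyY, hyp⟩
    exact hy' y hyY hyp rfl
  have hgain := h {p} {y} hF (by simp) hG
  have hgain' : surgeryGain Y {p} {y} =
      (∑' w : ↥(Y \ ↑({p} : Finset E3)), lennardJones (dist p (w : E3))) -
        ∑' w : ↥(Y \ ↑({p} : Finset E3)), lennardJones (dist y (w : E3)) := by
    simp only [surgeryGain, Finset.sum_singleton, dist_self, lennardJones_zero, mul_zero, zero_add]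
  rw [hgain'] at hgain
  -- transport the sums to lens-3's index type
  have key : ∀ q : E3, (μS Y {q} ≠ 0 ∧ q ≠ p) ↔ q ∈ Y \ (↑({p} : Finset E3) : Set E3) := fun q => by
    rw [Literature.Probability.Process.count_restrict_singleton_ne_zero_iff, Finset.coe_singleton, Set.mem_sdiff_singleton]
  let e : {q : E3 // μS Y {q} ≠ 0 ∧ q ≠ p} ≃ ↥(Y \ (↑({p} : Finset E3) : Set E3)) := Equiv.subtypeEquivRight key
  have hA : (∑' q : {q : E3 // μS Y {q} ≠ 0 ∧ q ≠ p}, lennardJones (dist p (q : E3))) =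
      ∑' w : ↥(Y \ ↑({p} : Finset E3)), lennardJones (dist p (w : E3)) :=
    Equiv.tsum_eq e (fun w : ↥(Y \ (↑({p} : Finset E3) : Set E3)) => lennardJones (dist p (w : E3)))
  have hB : (∑' q : {q : E3 // μS Y {q} ≠ 0 ∧ q ≠ p}, lennardJones (dist y (q : E3))) =
      ∑' w : ↥(Y \ ↑({p} : Finset E3)), lennardJones (dist y (w : E3)) :=
    Equiv.tsum_eq e (fun w : ↥(Y \ (↑({p} : Finset E3) : Set E3)) => lennardJones (dist y (w : E3)))
  show (∑' q : {q : E3 // μS Y {q} ≠ 0 ∧ q ≠ p}, lennardJones (dist p (q : E3))) ≤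
    ∑' q : {q : E3 // μS Y {q} ≠ 0 ∧ q ≠ p}, lennardJones (dist y (q : E3))
  rw [hA, hB]
  linarith

end Summit.AtomisticToContinuum.Crystallization.Theorems.OverbindingBudgetLiouvilleDictionary

end
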